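/-
Copyright (c) 2026 the pub-hodgecm-mathlib formalisation cell (harness21).  Prover seat hodgecm-mathlib-K2E3-p05 (g2), Track B «K2-LIT», engine E3, unit U4 «Keys»,
2026-09-04.  KERNEL module: THEOREMS ONLY (no definition, no named fact, no `sorry`, no instance, no notation).
-/
import Literature.NumberTheory.Automorphic.UnitaryBruhatIwahoriThree      -- ★ FILE 1∕2 (LH5-p05): Iwahori test, Hermitian upgrade, `w`-conjugation entries; brings ★ BigCell (`exists_coe_eq_lower`, `sum_rel_of_mem`)
import Literature.NumberTheory.Automorphic.CMPrincipalSeriesSpherical     -- ★ `val_proj_borelTriple` (the Levi projection reads off the diagonal)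
import HarnessLib

/-!
# K2 ∕ E3 «EllipticInputs», unit U4 «Keys» — Road II of MEMO `hK-KeysThmTwo`, stub II-3 (first brick) «THE IWAHORI FACTORISATION OF `I`»:
# every element of the Iwahori subgroup `I = K₀ ⊓ K₁` of `U(σ, Φ₃)(K)` is `n̄ · m · n` with `n̄ ∈ I ∩ N̄`, `m ∈ I ∩ T`, `n ∈ I ∩ N` (`N̄ = w N w`)
# [BruhatTits1972 (4.4.3)–(4.4.4); Casselman1995 Prop. 1.4.4; Tits1979 §3.7; Rogawski1990 §1.10]

Cell hodgecm-mathlib (D-0151), FLOOR 0, Track B «K2-LIT», engine E3, crux item H413 = stmt-HodgeConjecture-24833 (route `HCCMUnconditional`, no route verbs); target BY NAME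
`…K2E3EllipticInputs.U4Keys.sig_K2E3KeysThmTwoContracting` (U4-f, U4Keys ED. 3), unramified first rung (Road II): the DETECTION step II-3 («a non-zero `G`-stable subspace of an
unramified principal series has an `I`-fixed vector») runs through Jacquet's lemma ★ `JacquetLemma.fixedPoints_jacquetModule_le_map` for an Iwahori datum whose level is `I`
itself, and the ONE field of ★ `ParabolicTriple.IwahoriDatum` not yet in the tree for `I` is the factorisation `I = (I ∩ N̄)(I ∩ T)(I ∩ N)` (★ `coe_comap_congruenceGL_eq_mul` is the
principal-congruence twin; ★ `UnitaryLatticeTreeLevelGroups` lists «(U6) product ∕ Iwahori factorisation» as EXCLUDED).  Author K2E3-p05 (g2).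
`--supports stmt-HodgeConjecture-24833 --as helper`; THEOREMS ONLY; MODEL level (`U(σ, Φ₃)(K)`, any isometric involution, letters of ★ FILE 1: `hσ hvσ hvϖ; hJ; g₁ hg₁`).

THE MATHEMATICS.  Let `g ∈ I`: all entries integral, `g₁₀, g₂₀, g₂₁ ∈ 𝔭` (★ THE IWAHORI TEST), so `g₀₀` is a unit (the last row of `g⁻¹ ∈ K₀` is `σ` of the first column of `g`
reversed, and no row of an element of `K₀` lies in `𝔭³`).  Put `p := -σ g₁₀ ∕ σ g₀₀`, `q := g₂₀ ∕ g₀₀`; the isotropy of the first column (★ `col_zero_isotropic`: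
`σg₀₀·g₂₀ + σg₁₀·g₁₀ + σg₂₀·g₀₀ = 0`) is exactly the relation `q + σq + pσp = 0` making `n̄ := ū(p, q) = !![1,0,0; -σp,1,0; q,p,1]` unitary (★ `exists_coe_eq_lower`); `n̄ ∈ I`
(integral, `(2,0)` entry `q ∈ 𝔭`: Hermitian upgrade) and `n̄ = w·(w n̄ w)·w ∈ w N w = N̄` (★ `weylLongU_mul_mul_weylLongU_mem_unipotentU`).  The first column of `b := n̄⁻¹ g` is
`(g₀₀, 0, 0)` (`(n̄⁻¹)ᵢⱼ = σ n̄_{rev j, rev i}`, ★ `coe_inv_apply_eq`, and isotropy again), and a unitary matrix with `b₁₀ = b₂₀ = 0` has `b₂₁ = 0` (the `(0,1)` Hermitian relation ★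
`sum_rel_of_mem`: `σb₀₀·b₂₁ = 0`), so `b ∈ B ∩ I`; finally `b = m·n` with `m = proj b ∈ T` diagonal with the (integral, unit) diagonal of `b` (★ `val_proj_borelTriple`) — so `m ∈ I` —
and `n = m⁻¹ b ∈ N ∩ I` (★ `ParabolicTriple.proj_inv_mul_mem`).  Hence **`g = n̄ m n`** and, as sets, **`I = (I ∩ N̄)·(I ∩ T)·(I ∩ N)`** — the `factorization` field of an Iwahori
datum at level `I` (the sequel `K2E3IwahoriDatumIwahoriLevel` assembles the datum; the detection II-3 and the assembly II-4 follow).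
§1 `v_apply_zero_zero_eq_one_of_mem_inf` (the pivot) · §2 `exists_lowerU_mul_borel_of_mem_inf` (`g = n̄ b`) · §3 `exists_nbar_mul_torus_mul_unipotent_of_mem_inf` (`g = n̄ m n`),
`coe_inf_eq_mul` (the set identity in the datum's letters `(borelTriple σ J hJ).M ∕ .N`, `N̄ = N.map (conj w)`).
HONEST LABEL: HC_CM is proved only modulo the 7 printed citations (2 remaining named inputs: hLiu418 = stmt-HodgeConjecture-24832, h413 = stmt-HodgeConjecture-24833)
until rung 0 closes; count-neutral (group theory; no printed citation is discharged).

## References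
* [BruhatTits1972] F. Bruhat, J. Tits, *Groupes réductifs sur un corps local I*, Publ. Math. IHÉS 41 (1972), (4.4.3)–(4.4.4).
* [Casselman1995] W. Casselman, *Introduction to the theory of admissible representations of p-adic reductive groups* (1995), Prop. 1.4.4.
* [Tits1979] J. Tits, *Reductive groups over local fields*, PSPM 33.1 (1979), §3.7.  * [Rogawski1990] J. D. Rogawski, Ann. of Math. Stud. 123 (1990), §1.9–§1.10 pp. 8–9.
-/

set_option autoImplicit false
-- the mandated namespace has the single-problem summit's repeated segment (`HodgeConjecture.HodgeConjecture`)
set_option linter.dupNamespace false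

noncomputable section

open Matrix Literature.NumberTheory.Automorphic Literature.NumberTheory.Automorphic.UnitaryGroup
open scoped Matrix MatrixGroups WithZero Pointwise

namespace Summit.HodgeConjecture.HodgeConjecture.Cruxes.H413.K2E3IwahoriFactorisationThree

variable {K : Type*} [Field K] [Valued K ℤᵐ⁰] [ValuativeRel K] [(Valued.v : Valuation K ℤᵐ⁰).Compatible]
  (σ : K →+* K) {ϖ : K} {J : Matrix (Fin 3) (Fin 3) K} (hJ : J = (StdForm.antidiagonal 3).over K)
  (hσ : ∀ a, σ (σ a) = a) (hvσ : ∀ a, Valued.v (σ a) = Valued.v a) (hvϖ : Valued.v ϖ = WithZero.exp (-1 : ℤ))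
  (g₁ : GL (Fin 3) K) (hg₁ : (g₁ : Matrix (Fin 3) (Fin 3) K) = Matrix.diagonal ![(1 : K), 1, ϖ])

/-! ## §1 The pivot: `g₀₀` is a unit for `g ∈ I` -/

include hJ hvσ hvϖ hg₁ in
/-- **The `(0,0)` entry of an element of `I` is a unit.**  `g₁₀, g₂₀ ∈ 𝔭` (Iwahori test); the last row of `g⁻¹ ∈ K₀` is `(σg₂₀, σg₁₀, σg₀₀)` (★ `coe_inv_apply_eq`) and no row
of an element of `K₀` lies in `𝔭³` (★ `not_forall_v_apply_lt_one_of_mem_glInt_subgroupOf`). [cite: BruhatTits1972, (4.4.4)] [cite: Tits1979, §3.7] -/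
theorem v_apply_zero_zero_eq_one_of_mem_inf {g : ↥(unitaryGroupOfForm σ J)}
    (hg : g ∈ (glInt 3 K).subgroupOf (unitaryGroupOfForm σ J) ⊓ ((glInt 3 K).map (MulAut.conj g₁).toMonoidHom).subgroupOf (unitaryGroupOfForm σ J)) :
    Valued.v (((g : GL (Fin 3) K) : Matrix (Fin 3) (Fin 3) K) 0 0) = 1 := by
  obtain ⟨hint, h20, -, h10⟩ := (mem_glInt_inf_conj_glInt_iff σ hJ hvσ hvϖ g₁ hg₁ g).1 hg
  refine le_antisymm (hint 0 0) ?_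
  by_contra h00
  rw [not_le] at h00
  have hK0 : g⁻¹ ∈ (glInt 3 K).subgroupOf (unitaryGroupOfForm σ J) := Subgroup.inv_mem _ (Subgroup.mem_inf.1 hg).1
  refine not_forall_v_apply_lt_one_of_mem_glInt_subgroupOf σ hJ hvσ hK0 2 fun j => ?_
  rw [coe_inv_apply_eq σ hJ g 2 j, hvσ]
  fin_cases j
  · exact h20
  · exact h10
  · exact h00

/-! ## §2 `g = n̄ · b` with `n̄ ∈ I ∩ N̄`, `b ∈ I ∩ B` -/

include hJ hσ hvσ hvϖ hg₁ in
set_option maxHeartbeats 1600000 in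
-- nine-entry matrix bookkeeping for `n̄⁻¹ g` (three `Fin.sum_univ_three` expansions and the isotropy relation)
/-- **`g = n̄ · b`** for `g ∈ I`: `n̄ = ū(p, q) ∈ I ∩ w N w` with `p = -σg₁₀∕σg₀₀`, `q = g₂₀∕g₀₀` (unitary by the isotropy of the first column of `g`), and `b = n̄⁻¹ g ∈ I` is upper
triangular (`b₁₀ = b₂₀ = 0` by construction, `b₂₁ = 0` by the `(0,1)` Hermitian relation). [cite: BruhatTits1972, (4.4.3)] [cite: Casselman1995, Prop. 1.4.4] [cite: Rogawski1990, §1.10 p. 9] -/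
theorem exists_lowerU_mul_borel_of_mem_inf {g : ↥(unitaryGroupOfForm σ J)}
    (hg : g ∈ (glInt 3 K).subgroupOf (unitaryGroupOfForm σ J) ⊓ ((glInt 3 K).map (MulAut.conj g₁).toMonoidHom).subgroupOf (unitaryGroupOfForm σ J)) :
    ∃ nb b : ↥(unitaryGroupOfForm σ J),
      nb ∈ (glInt 3 K).subgroupOf (unitaryGroupOfForm σ J) ⊓ ((glInt 3 K).map (MulAut.conj g₁).toMonoidHom).subgroupOf (unitaryGroupOfForm σ J) ∧
      nb ∈ ((borelTriple σ J hJ).N).map (MulAut.conj (weylLongU σ hJ)).toMonoidHom ∧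
      b ∈ (glInt 3 K).subgroupOf (unitaryGroupOfForm σ J) ⊓ ((glInt 3 K).map (MulAut.conj g₁).toMonoidHom).subgroupOf (unitaryGroupOfForm σ J) ∧
      b ∈ borelU σ J ∧ g = nb * b := by
  obtain ⟨hint, h20, h21, h10⟩ := (mem_glInt_inf_conj_glInt_iff σ hJ hvσ hvϖ g₁ hg₁ g).1 hg
  have h00 := v_apply_zero_zero_eq_one_of_mem_inf σ hJ hvσ hvϖ g₁ hg₁ hg
  -- names for the first column
  set a : K := ((g : GL (Fin 3) K) : Matrix (Fin 3) (Fin 3) K) 0 0 with ha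
  set b₁ : K := ((g : GL (Fin 3) K) : Matrix (Fin 3) (Fin 3) K) 1 0 with hb₁
  set c : K := ((g : GL (Fin 3) K) : Matrix (Fin 3) (Fin 3) K) 2 0 with hc
  have ha0 : a ≠ 0 := fun h => by rw [h, map_zero] at h00; exact zero_ne_one h00
  have hσa0 : σ a ≠ 0 := (map_ne_zero σ).2 ha0
  have hiso : σ a * c + σ b₁ * b₁ + σ c * a = 0 := col_zero_isotropic σ hJ g
  -- the lower unitriangular `n̄ = ū(p, q)`
  set p : K := -(σ b₁ / σ a) with hp
  set q : K := c / a with hq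
  have hσp : σ p = -(b₁ / a) := by rw [hp, map_neg, map_div₀, hσ, hσ]
  have hσq : σ q = σ c / σ a := by rw [hq, map_div₀]
  have hrel : q + σ q + p * σ p = 0 := by
    rw [hσq, hσp, hp, hq]
    field_simp
    linear_combination hiso
  obtain ⟨nb, hnb⟩ := exists_coe_eq_lower σ hJ hσ hrel
  have hvp : Valued.v p < 1 := by
    rw [hp, Valuation.map_neg, map_div₀, hvσ, hvσ, h00, div_one]; exact h10
  have hvq : Valued.v q < 1 := by
    rw [hq, map_div₀, h00, div_one]; exact h20
  -- `n̄ ∈ I`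
  have hnbK0 : nb ∈ (glInt 3 K).subgroupOf (unitaryGroupOfForm σ J) := by
    rw [mem_glInt_subgroupOf_iff σ hJ hvσ, hnb]
    intro i j
    fin_cases i <;> fin_cases j <;> simp [hvσ, hvp.le, hvq.le]
  have hnbI : nb ∈ (glInt 3 K).subgroupOf (unitaryGroupOfForm σ J) ⊓ ((glInt 3 K).map (MulAut.conj g₁).toMonoidHom).subgroupOf (unitaryGroupOfForm σ J) :=
    mem_glInt_inf_conj_glInt_of_v_lt_one σ hJ hvσ hvϖ g₁ hg₁ hnbK0 (by rw [hnb]; simpa using hvq)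
  -- `n̄ ∈ N̄ = w N w`
  have hlow : ∀ i j : Fin 3, i < j → ((nb : GL (Fin 3) K) : Matrix (Fin 3) (Fin 3) K) i j = 0 := by
    intro i j hij; rw [hnb]; fin_cases i <;> fin_cases j <;> simp at hij ⊢
  have hdiag : ∀ i : Fin 3, ((nb : GL (Fin 3) K) : Matrix (Fin 3) (Fin 3) K) i i = 1 := by
    intro i; rw [hnb]; fin_cases i <;> simp
  have hw : weylLongU σ hJ * weylLongU σ hJ = 1 := weylLongU_mul_weylLongU σ hJ
  have hnbN : nb ∈ ((borelTriple σ J hJ).N).map (MulAut.conj (weylLongU σ hJ)).toMonoidHom := by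
    refine ⟨weylLongU σ hJ * nb * weylLongU σ hJ, ?_, ?_⟩
    · rw [borelTriple_N]; exact weylLongU_mul_mul_weylLongU_mem_unipotentU σ hJ hlow hdiag
    · change weylLongU σ hJ * (weylLongU σ hJ * nb * weylLongU σ hJ) * (weylLongU σ hJ)⁻¹ = nb
      rw [inv_eq_of_mul_eq_one_right hw, ← mul_assoc, ← mul_assoc, hw, one_mul, mul_assoc, hw, mul_one]
  -- the entries of `n̄`
  have e00 : ((nb : GL (Fin 3) K) : Matrix (Fin 3) (Fin 3) K) 0 0 = 1 := by rw [hnb]; rfl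
  have e11 : ((nb : GL (Fin 3) K) : Matrix (Fin 3) (Fin 3) K) 1 1 = 1 := by rw [hnb]; rfl
  have e22 : ((nb : GL (Fin 3) K) : Matrix (Fin 3) (Fin 3) K) 2 2 = 1 := by rw [hnb]; rfl
  have e01 : ((nb : GL (Fin 3) K) : Matrix (Fin 3) (Fin 3) K) 0 1 = 0 := by rw [hnb]; rfl
  have e02 : ((nb : GL (Fin 3) K) : Matrix (Fin 3) (Fin 3) K) 0 2 = 0 := by rw [hnb]; rfl
  have e12 : ((nb : GL (Fin 3) K) : Matrix (Fin 3) (Fin 3) K) 1 2 = 0 := by rw [hnb]; rfl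
  have e10 : ((nb : GL (Fin 3) K) : Matrix (Fin 3) (Fin 3) K) 1 0 = -σ p := by rw [hnb]; rfl
  have e20 : ((nb : GL (Fin 3) K) : Matrix (Fin 3) (Fin 3) K) 2 0 = q := by rw [hnb]; rfl
  have e21 : ((nb : GL (Fin 3) K) : Matrix (Fin 3) (Fin 3) K) 2 1 = p := by rw [hnb]; rfl
  -- `b = n̄⁻¹ g`: its first column is `(a, 0, 0)`
  have hinv : ∀ i j, (((nb⁻¹ : ↥(unitaryGroupOfForm σ J)) : GL (Fin 3) K) : Matrix (Fin 3) (Fin 3) K) i j =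
      σ (((nb : GL (Fin 3) K) : Matrix (Fin 3) (Fin 3) K) (Fin.rev j) (Fin.rev i)) := fun i j => coe_inv_apply_eq σ hJ nb i j
  have hmul : ∀ i j, (((nb⁻¹ * g : ↥(unitaryGroupOfForm σ J)) : GL (Fin 3) K) : Matrix (Fin 3) (Fin 3) K) i j =
      ∑ k, (((nb⁻¹ : ↥(unitaryGroupOfForm σ J)) : GL (Fin 3) K) : Matrix (Fin 3) (Fin 3) K) i k * ((g : GL (Fin 3) K) : Matrix (Fin 3) (Fin 3) K) k j := by
    intro i j; rw [Subgroup.coe_mul, Units.val_mul, Matrix.mul_apply]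
  have r0 : Fin.rev (0 : Fin 3) = 2 := rfl
  have r1 : Fin.rev (1 : Fin 3) = 1 := rfl
  have r2 : Fin.rev (2 : Fin 3) = 0 := rfl
  have hb10 : (((nb⁻¹ * g : ↥(unitaryGroupOfForm σ J)) : GL (Fin 3) K) : Matrix (Fin 3) (Fin 3) K) 1 0 = 0 := by
    rw [hmul, Fin.sum_univ_three, hinv, hinv, hinv, r0, r1, r2, e21, e11, e01, map_one, map_zero, hσp, ← ha, ← hb₁, ← hc]
    field_simp
    ring
  have hb20 : (((nb⁻¹ * g : ↥(unitaryGroupOfForm σ J)) : GL (Fin 3) K) : Matrix (Fin 3) (Fin 3) K) 2 0 = 0 := by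
    rw [hmul, Fin.sum_univ_three, hinv, hinv, hinv, r0, r1, r2, e20, e10, e00, map_one, map_neg, hσ, hσq, hp, ← ha, ← hb₁, ← hc]
    field_simp
    linear_combination hiso
  -- `b₂₁ = 0` by the `(0,1)` Hermitian relation
  have hb21 : (((nb⁻¹ * g : ↥(unitaryGroupOfForm σ J)) : GL (Fin 3) K) : Matrix (Fin 3) (Fin 3) K) 2 1 = 0 := by
    have hb00 : (((nb⁻¹ * g : ↥(unitaryGroupOfForm σ J)) : GL (Fin 3) K) : Matrix (Fin 3) (Fin 3) K) 0 0 = a := by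
      rw [hmul, Fin.sum_univ_three, hinv, hinv, hinv, r0, r1, r2, e22, e12, e02, map_one, map_zero, ← ha, ← hb₁, ← hc]; ring
    have r := sum_rel_of_mem σ hJ (nb⁻¹ * g) 0 1
    simp only [Fin.sum_univ_three, r0, r1, r2, hb10, hb20, hb00, map_zero, zero_mul, add_zero] at r
    have r' : σ a * (((nb⁻¹ * g : ↥(unitaryGroupOfForm σ J)) : GL (Fin 3) K) : Matrix (Fin 3) (Fin 3) K) 2 1 = 0 := by
      simpa using r
    exact (mul_eq_zero.1 r').resolve_left hσa0
  refine ⟨nb, nb⁻¹ * g, hnbI, hnbN, Subgroup.mul_mem _ (Subgroup.inv_mem _ hnbI) hg, ?_, by rw [mul_inv_cancel_left]⟩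
  rw [mem_borelU_iff]
  intro i j hij
  fin_cases i <;> fin_cases j
  all_goals first | exact absurd hij (by decide) | exact hb10 | exact hb20 | exact hb21

/-! ## §3 `g = n̄ · m · n` and the set identity `I = (I ∩ N̄)(I ∩ T)(I ∩ N)` -/

include hJ hσ hvσ hvϖ hg₁ in
set_option maxHeartbeats 800000 in
-- the Levi projection's matrix and two Iwahori tests
/-- **THE IWAHORI FACTORISATION, elementwise**: every `g ∈ I` is `n̄ · m · n` with `n̄ ∈ I ∩ N̄`, `m ∈ I ∩ T`, `n ∈ I ∩ N` (`T = (borelTriple σ J hJ).M`, `N = (borelTriple σ J hJ).N`,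
`N̄ = N.map (conj w)`): §2, then `b = proj b · ((proj b)⁻¹ b)` (★ `ParabolicTriple.proj_inv_mul_mem`) with `proj b = diag(bᵢᵢ)` integral (★ `val_proj_borelTriple`), hence in `I`.
[cite: BruhatTits1972, (4.4.3)–(4.4.4)] [cite: Casselman1995, Prop. 1.4.4] [cite: Tits1979, §3.7] -/
theorem exists_nbar_mul_torus_mul_unipotent_of_mem_inf {g : ↥(unitaryGroupOfForm σ J)}
    (hg : g ∈ (glInt 3 K).subgroupOf (unitaryGroupOfForm σ J) ⊓ ((glInt 3 K).map (MulAut.conj g₁).toMonoidHom).subgroupOf (unitaryGroupOfForm σ J)) :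
    ∃ nb m n : ↥(unitaryGroupOfForm σ J),
      nb ∈ (glInt 3 K).subgroupOf (unitaryGroupOfForm σ J) ⊓ ((glInt 3 K).map (MulAut.conj g₁).toMonoidHom).subgroupOf (unitaryGroupOfForm σ J) ∧
      nb ∈ ((borelTriple σ J hJ).N).map (MulAut.conj (weylLongU σ hJ)).toMonoidHom ∧
      m ∈ (glInt 3 K).subgroupOf (unitaryGroupOfForm σ J) ⊓ ((glInt 3 K).map (MulAut.conj g₁).toMonoidHom).subgroupOf (unitaryGroupOfForm σ J) ∧
      m ∈ (borelTriple σ J hJ).M ∧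
      n ∈ (glInt 3 K).subgroupOf (unitaryGroupOfForm σ J) ⊓ ((glInt 3 K).map (MulAut.conj g₁).toMonoidHom).subgroupOf (unitaryGroupOfForm σ J) ∧
      n ∈ (borelTriple σ J hJ).N ∧ g = nb * m * n := by
  obtain ⟨nb, b, hnbI, hnbN, hbI, hbB, hg'⟩ := exists_lowerU_mul_borel_of_mem_inf σ hJ hσ hvσ hvϖ g₁ hg₁ hg
  have hbP : b ∈ (borelTriple σ J hJ).P := by rw [borelTriple_P]; exact hbB
  set m : ↥(unitaryGroupOfForm σ J) := (((borelTriple σ J hJ).proj ⟨b, hbP⟩ : ↥(borelTriple σ J hJ).M) : ↥(unitaryGroupOfForm σ J)) with hm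
  have hmM : m ∈ (borelTriple σ J hJ).M := ((borelTriple σ J hJ).proj ⟨b, hbP⟩).2
  have hnN : m⁻¹ * b ∈ (borelTriple σ J hJ).N := (borelTriple σ J hJ).proj_inv_mul_mem ⟨b, hbP⟩
  -- `m = diag(bᵢᵢ)` is integral with unit-free lower entries: `m ∈ I`
  have hbint := (mem_glInt_subgroupOf_iff σ hJ hvσ b).1 (Subgroup.mem_inf.1 hbI).1
  have hmval : ((m : GL (Fin 3) K) : Matrix (Fin 3) (Fin 3) K) = Matrix.diagonal fun i => ((b : GL (Fin 3) K) : Matrix (Fin 3) (Fin 3) K) i i :=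
    val_proj_borelTriple σ J hJ ⟨b, hbP⟩
  have hmK0 : m ∈ (glInt 3 K).subgroupOf (unitaryGroupOfForm σ J) := by
    rw [mem_glInt_subgroupOf_iff σ hJ hvσ, hmval]
    intro i j
    rw [Matrix.diagonal_apply]
    split_ifs with hij
    · exact hbint i i
    · rw [map_zero]; exact zero_le
  have hmI : m ∈ (glInt 3 K).subgroupOf (unitaryGroupOfForm σ J) ⊓ ((glInt 3 K).map (MulAut.conj g₁).toMonoidHom).subgroupOf (unitaryGroupOfForm σ J) :=
    mem_glInt_inf_conj_glInt_of_v_lt_one σ hJ hvσ hvϖ g₁ hg₁ hmK0 (by rw [hmval, Matrix.diagonal_apply_ne _ (by decide), map_zero]; exact zero_lt_one)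
  refine ⟨nb, m, m⁻¹ * b, hnbI, hnbN, hmI, hmM, Subgroup.mul_mem _ (Subgroup.inv_mem _ hmI) hbI, hnN, ?_⟩
  rw [hg', mul_assoc, mul_inv_cancel_left]

include hJ hσ hvσ hvϖ hg₁ in
/-- **THE IWAHORI FACTORISATION as a set identity**: `I = (I ∩ N̄)·(I ∩ T)·(I ∩ N)` — the `factorization` field of ★ `ParabolicTriple.IwahoriDatum` for the Borel triple of `U(σ, Φ₃)(K)`
at the IWAHORI level `I = K₀ ⊓ K₁` (★ `coe_comap_congruenceGL_eq_mul` is the principal-congruence level). [cite: Casselman1995, Prop. 1.4.4] [cite: BruhatTits1972, (4.4.4)] -/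
theorem coe_inf_eq_mul :
    (((glInt 3 K).subgroupOf (unitaryGroupOfForm σ J) ⊓ ((glInt 3 K).map (MulAut.conj g₁).toMonoidHom).subgroupOf (unitaryGroupOfForm σ J) :
        Subgroup ↥(unitaryGroupOfForm σ J)) : Set ↥(unitaryGroupOfForm σ J)) =
      ((((glInt 3 K).subgroupOf (unitaryGroupOfForm σ J) ⊓ ((glInt 3 K).map (MulAut.conj g₁).toMonoidHom).subgroupOf (unitaryGroupOfForm σ J)) ⊓
          ((borelTriple σ J hJ).N).map (MulAut.conj (weylLongU σ hJ)).toMonoidHom : Subgroup ↥(unitaryGroupOfForm σ J)) : Set ↥(unitaryGroupOfForm σ J)) *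
        ((((glInt 3 K).subgroupOf (unitaryGroupOfForm σ J) ⊓ ((glInt 3 K).map (MulAut.conj g₁).toMonoidHom).subgroupOf (unitaryGroupOfForm σ J)) ⊓
          (borelTriple σ J hJ).M : Subgroup ↥(unitaryGroupOfForm σ J)) : Set ↥(unitaryGroupOfForm σ J)) *
        ((((glInt 3 K).subgroupOf (unitaryGroupOfForm σ J) ⊓ ((glInt 3 K).map (MulAut.conj g₁).toMonoidHom).subgroupOf (unitaryGroupOfForm σ J)) ⊓
          (borelTriple σ J hJ).N : Subgroup ↥(unitaryGroupOfForm σ J)) : Set ↥(unitaryGroupOfForm σ J)) := by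
  ext g
  constructor
  · intro hg
    obtain ⟨nb, m, n, hnbI, hnbN, hmI, hmM, hnI, hnN, rfl⟩ := exists_nbar_mul_torus_mul_unipotent_of_mem_inf σ hJ hσ hvσ hvϖ g₁ hg₁ hg
    exact Set.mul_mem_mul (Set.mul_mem_mul (Subgroup.mem_inf.2 ⟨hnbI, hnbN⟩) (Subgroup.mem_inf.2 ⟨hmI, hmM⟩)) (Subgroup.mem_inf.2 ⟨hnI, hnN⟩)
  · rintro ⟨_, ⟨nb, hnb, m, hm, rfl⟩, n, hn, rfl⟩
    exact Subgroup.mul_mem _ (Subgroup.mul_mem _ (Subgroup.mem_inf.1 hnb).1 (Subgroup.mem_inf.1 hm).1) (Subgroup.mem_inf.1 hn).1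

end Summit.HodgeConjecture.HodgeConjecture.Cruxes.H413.K2E3IwahoriFactorisationThree

end
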